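import Literature.Analysis.OperatorTheory.PositiveKernelEigenfunction
import Literature.Probability.LatticeModels.MarkovChainMeasure
import Literature.MathematicalPhysics.KineticTheory.InfiniteChainMarkovGibbs
import Literature.MathematicalPhysics.KineticTheory.InfiniteChainMarkovSuperstable
import HarnessLib

/-!
# Existence of a superstable infinite-volume Gibbs state of the anharmonic chain
# (transfer-operator / Markov-chain construction) — PROVED

Topic `Literature/MathematicalPhysics/KineticTheory`; theorems only (no definitions, no named
facts). This file assembles the classical one-dimensional construction (Cassandro–Olivieri–
Pellegrinotti–Presutti, Z. Wahrsch. 41 (1978) §2; Georgii 2011, Thm 10.25, §11.1; Ruelle 1976 /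
Lebowitz–Presutti 1976 for superstability) of a DLR Gibbs state of the nearest-neighbour
oscillator chain `P : OscillatorChain` at temperature `T > 0`:

1. one-particle a priori measure `ρ_T(dq dp) = e^{-(p²/2+U(q))/T} dq dp` (finite), bond transfer
   kernel `K(z, z') = e^{-V(q'-q)/T}` (bounded by `1`, symmetric, strictly positive);
2. Jentzsch: a pointwise eigenfunction `h > 0`, `h ≤ B`, `∫ K(·,y) h(y) dρ_T = λ₀ h`, `∫ h² dρ_T = 1`
   (`Literature.Analysis.OperatorTheory.exists_pointwise_eigenfunction_lintegral`);
3. the two-sided stationary Markov chain `μ` with window densities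
   `h(σ_a) h(σ_{a+n}) ∏ (K λ₀⁻¹) ∏ e^{-(p²/2+U)/T}` (Kolmogorov extension,
   `Literature.Probability.LatticeModels.exists_markovChainMeasure`);
4. DLR for every finite `Λ` (`OscillatorChain.isChainGibbsMeasure_of_windowDensity`);
5. Buttà–Marchioro's superstability estimate (2.3)
   (`OscillatorChain.hasSuperstabilityEstimate_of_windowDensity`).

* `exists_isChainGibbsMeasure_hasSuperstabilityEstimate` — for `T > 0`, `U, V` continuous,
  `U, V ≥ 0`, `V` even, `e^{-U/T}, e^{-U/(2T)} ∈ L¹`: **there is a DLR Gibbs state of `P` at `T`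
  obeying BM (2.3)**;
* `exists_isChainGibbsMeasure_hasSuperstabilityEstimate_pinnedChain` — the tree's pinned
  anharmonic chain `pinnedChain ω₂ lam β γ` (`ω₂ > 0`, `lam, β ≥ 0`) at every `T > 0`.

[cite: Georgii2011, Thm 10.25 and §11.1] [cite: ButtaMarchioro2016, §2 eq. (2.3)]
-/

noncomputable section

open MeasureTheory Set Function Finset Filter Literature.Probability.LatticeModels
  Literature.Analysis.OperatorTheory
open scoped ENNReal

namespace Literature.MathematicalPhysics.KineticTheory.HeatConduction

namespace OscillatorChain

variable (P : OscillatorChain)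

/-- **Factorisation of the Boltzmann weight (`ℝ≥0∞` form)**:
`e^{-H_Λ/T} = ∏_{x∈Λ} e^{-(p_x²/2+U(q_x))/T} ∏_{y∈bondSet Λ} e^{-V(q_{y+1}-q_y)/T}`. [folklore] -/
theorem ofReal_exp_neg_hamiltonianIn (T : ℝ) (Λ : Finset ℤ) (σ : ChainConfig) :
    ENNReal.ofReal (Real.exp (-T⁻¹ * hamiltonianIn P.chainPotential chainSupp Λ σ)) =
      (∏ x ∈ Λ, ENNReal.ofReal (Real.exp (-T⁻¹ * ((σ x).2 ^ 2 / 2 + P.U (σ x).1)))) *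
        ∏ y ∈ bondSet Λ, ENNReal.ofReal (Real.exp (-T⁻¹ * P.V ((σ (y + 1)).1 - (σ y).1))) := by
  rw [hamiltonianIn_chain, mul_add, Finset.mul_sum, Finset.mul_sum, Real.exp_add, Real.exp_sum,
    Real.exp_sum, ENNReal.ofReal_mul (Finset.prod_nonneg fun _ _ => (Real.exp_pos _).le),
    ENNReal.ofReal_prod_of_nonneg fun _ _ => (Real.exp_pos _).le,
    ENNReal.ofReal_prod_of_nonneg fun _ _ => (Real.exp_pos _).le]

/-- **Existence of a superstable DLR Gibbs state of the chain (transfer-operator construction).**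
Let `T > 0`, `U`, `V` continuous and non-negative, `V` even, and `e^{-U/T}`, `e^{-U/(2T)}`
Lebesgue integrable. Then there is a probability measure `μ` on `ℤ → ℝ × ℝ` which is a Gibbs state
of `P` at temperature `T` (DLR equations for every finite volume) and satisfies Buttà–Marchioro's
superstability estimate (2.3). It is the law of the two-sided stationary Markov chain of the
transfer operator with kernel `e^{-V(q'-q)/T}` on `L²(e^{-(p²/2+U)/T} dq dp)`.
[cite: Georgii2011, Thm 10.25 and §11.1] -/
theorem exists_isChainGibbsMeasure_hasSuperstabilityEstimate {T : ℝ} (hT : 0 < T)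
    (hUc : Continuous P.U) (hVc : Continuous P.V) (hU0 : ∀ r, 0 ≤ P.U r) (hV0 : ∀ r, 0 ≤ P.V r)
    (hVe : ∀ r, P.V (-r) = P.V r)
    (hUi : Integrable (fun q : ℝ => Real.exp (-T⁻¹ * P.U q)))
    (hUi2 : Integrable (fun q : ℝ => Real.exp (-(2 * T)⁻¹ * P.U q))) :
    ∃ μ : Measure ChainConfig, P.IsChainGibbsMeasure T μ ∧ P.HasSuperstabilityEstimate μ := by
  classical
  have hUm : Measurable P.U := hUc.measurable
  have hVm : Measurable P.V := hVc.measurable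
  -- Step 1: the a priori measure `ρ_T` and the transfer kernel `K`
  obtain ⟨wt, hwt⟩ : ∃ wt : ℝ × ℝ → ℝ, ∀ z, wt z = Real.exp (-T⁻¹ * (z.2 ^ 2 / 2 + P.U z.1)) :=
    ⟨_, fun _ => rfl⟩
  have hwt_eq : wt = fun z => Real.exp (-T⁻¹ * (z.2 ^ 2 / 2 + P.U z.1)) := funext hwt
  have hwtc : Continuous wt := by rw [hwt_eq]; fun_prop
  have hwti : Integrable wt := by rw [hwt_eq]; exact P.integrable_siteWeight hT hUi
  have hwtpos : ∀ z, 0 < wt z := fun z => by rw [hwt]; exact Real.exp_pos _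
  set ρ : Measure (ℝ × ℝ) := volume.withDensity fun z => ENNReal.ofReal (wt z) with hρ
  haveI : IsFiniteMeasure ρ := isFiniteMeasure_withDensity_ofReal hwti.2
  have hwtm : Measurable fun z => ENNReal.ofReal (wt z) := ENNReal.measurable_ofReal.comp hwtc.measurable
  have hρ0 : ρ ≠ 0 := by
    intro h0
    have h1 : ρ univ = 0 := by rw [h0]; rfl
    rw [hρ, withDensity_apply _ MeasurableSet.univ, Measure.restrict_univ,
      lintegral_eq_zero_iff hwtm] at h1
    have h2 : (volume : Measure (ℝ × ℝ)) {z | (fun z => ENNReal.ofReal (wt z)) z ≠ (0 : ℝ × ℝ → ℝ≥0∞) z} = 0 :=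
      h1
    have h3 : {z : ℝ × ℝ | (fun z => ENNReal.ofReal (wt z)) z ≠ (0 : ℝ × ℝ → ℝ≥0∞) z} = univ :=
      eq_univ_of_forall fun z => (ENNReal.ofReal_pos.2 (hwtpos z)).ne'
    rw [h3] at h2
    exact (isOpen_univ.measure_pos (volume : Measure (ℝ × ℝ)) univ_nonempty).ne' h2
  obtain ⟨K, hK⟩ : ∃ K : ℝ × ℝ → ℝ × ℝ → ℝ, ∀ z z', K z z' = Real.exp (-T⁻¹ * P.V (z'.1 - z.1)) :=
    ⟨_, fun _ _ => rfl⟩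
  have hKc : Continuous (uncurry K) := by
    rw [show uncurry K = fun p : (ℝ × ℝ) × (ℝ × ℝ) => Real.exp (-T⁻¹ * P.V (p.2.1 - p.1.1)) from
      funext fun p => hK p.1 p.2]
    fun_prop
  have hKsm : StronglyMeasurable (uncurry K) := hKc.stronglyMeasurable
  have hKpos : ∀ z z', 0 < K z z' := fun z z' => by rw [hK]; exact Real.exp_pos _
  have hK1 : ∀ z z', ‖K z z'‖ ≤ 1 := fun z z' => by
    rw [Real.norm_eq_abs, abs_of_pos (hKpos z z'), hK, Real.exp_le_one_iff]
    have := hV0 (z'.1 - z.1)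
    have := inv_pos.2 hT
    nlinarith
  have hKsymm : ∀ z z', K z z' = K z' z := fun z z' => by
    rw [hK, hK, ← hVe (z.1 - z'.1), neg_sub]
  -- Step 2: Jentzsch's pointwise eigenfunction
  obtain ⟨lam, h, B, hlam, hhm, hhpos, hhle, heig', hnorm'⟩ :=
    exists_pointwise_eigenfunction_lintegral (μ := ρ) hKsm hK1 hKsymm hKpos hρ0
  -- the `ℝ≥0∞` transfer data on Lebesgue measure
  obtain ⟨φ, hφ⟩ : ∃ φ : ℝ × ℝ → ℝ≥0∞, ∀ z, φ z = ENNReal.ofReal (h z) := ⟨_, fun _ => rfl⟩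
  obtain ⟨w, hw⟩ : ∃ w : ℝ × ℝ → ℝ≥0∞, ∀ z, w z = ENNReal.ofReal (wt z) := ⟨_, fun _ => rfl⟩
  obtain ⟨k, hk⟩ : ∃ k : ℝ × ℝ → ℝ × ℝ → ℝ≥0∞, ∀ z z', k z z' = ENNReal.ofReal (K z z') :=
    ⟨_, fun _ _ => rfl⟩
  set L : ℝ≥0∞ := ENNReal.ofReal lam with hL
  have hL0 : L ≠ 0 := (ENNReal.ofReal_pos.2 hlam).ne'
  have hLt : L ≠ ∞ := ENNReal.ofReal_ne_top
  have hφm : Measurable φ := by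
    rw [show φ = fun z => ENNReal.ofReal (h z) from funext hφ]
    exact ENNReal.measurable_ofReal.comp hhm
  have hwm : Measurable w := by
    rw [show w = fun z => ENNReal.ofReal (wt z) from funext hw]; exact hwtm
  have hkm : Measurable (uncurry k) := by
    rw [show uncurry k = fun p => ENNReal.ofReal (uncurry K p) from funext fun p => hk p.1 p.2]
    exact ENNReal.measurable_ofReal.comp hKc.measurable
  have hsym : ∀ z y, k z y = k y z := fun z y => by rw [hk, hk, hKsymm]
  have hφB : ∀ z, φ z ≤ ENNReal.ofReal B := fun z => by rw [hφ]; exact ENNReal.ofReal_le_ofReal (hhle z)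
  have hw' : ∀ z, w z = ENNReal.ofReal (Real.exp (-T⁻¹ * (z.2 ^ 2 / 2 + P.U z.1))) := fun z => by
    rw [hw, hwt]
  have hk' : ∀ z z', k z z' = ENNReal.ofReal (Real.exp (-T⁻¹ * P.V (z'.1 - z.1))) := fun z z' => by
    rw [hk, hK]
  -- the eigen-equation and the normalisation on Lebesgue measure
  have heig : ∀ z, ∫⁻ y, k z y * φ y * w y ∂(volume : Measure (ℝ × ℝ)) = L * φ z := by
    intro z
    have hg : Measurable fun y => ENNReal.ofReal (K z y) * ENNReal.ofReal (h y) :=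
      (ENNReal.measurable_ofReal.comp (hKc.measurable.comp (measurable_const.prodMk measurable_id))).mul
        (ENNReal.measurable_ofReal.comp hhm)
    have h1 := heig' z
    rw [hρ, lintegral_withDensity_eq_lintegral_mul _ hwtm hg] at h1
    rw [hL, hφ, ← ENNReal.ofReal_mul hlam.le, ← h1]
    refine lintegral_congr fun y => ?_
    simp only [Pi.mul_apply, hk, hφ, hw]
    ring
  have hnorm : ∫⁻ y, φ y ^ 2 * w y ∂(volume : Measure (ℝ × ℝ)) = 1 := by
    have hg : Measurable fun y => ENNReal.ofReal (h y) ^ 2 := (ENNReal.measurable_ofReal.comp hhm).pow_const 2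
    have h1 := hnorm'
    rw [hρ, lintegral_withDensity_eq_lintegral_mul _ hwtm hg] at h1
    rw [← h1]
    refine lintegral_congr fun y => ?_
    simp only [Pi.mul_apply, hφ, hw]
    ring
  -- Step 3: the two-sided stationary Markov chain
  obtain ⟨D, hD⟩ : ∃ D : ℤ → ℕ → ChainConfig → ℝ≥0∞, ∀ a n σ, D a n σ = φ (σ a) * φ (σ (a + n)) *
      (∏ j ∈ Finset.range n, k (σ (a + j)) (σ (a + j + 1)) * L⁻¹) *
      ∏ j ∈ Finset.range (n + 1), w (σ (a + j)) := ⟨_, fun _ _ _ => rfl⟩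
  obtain ⟨μ, hμprob, hμ⟩ := exists_markovChainMeasure (S := ℝ × ℝ) (ν := (volume : Measure (ℝ × ℝ)))
    hkm hφm hwm hL0 hLt heig hsym hnorm hD
  haveI := hμprob
  -- Step 4: DLR
  have hfac : ∀ (Λ : Finset ℤ) (σ : ChainConfig),
      ENNReal.ofReal (Real.exp (-T⁻¹ * hamiltonianIn P.chainPotential chainSupp Λ σ)) =
        (∏ x ∈ Λ, w (σ x)) * ∏ y ∈ bondSet Λ, k (σ y) (σ (y + 1)) := fun Λ σ => by
    rw [P.ofReal_exp_neg_hamiltonianIn T Λ σ]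
    simp only [hw', hk']
  have hZ : ∀ (Λ : Finset ℤ) (η : ChainConfig), (∫⋯∫⁻_Λ, (fun σ =>
      ENNReal.ofReal (Real.exp (-T⁻¹ * hamiltonianIn P.chainPotential chainSupp Λ σ)))
      ∂fun _ : ℤ => (volume : Measure (ℝ × ℝ))) η ≠ ∞ := fun Λ η =>
    (P.lmarginal_boltzmann_lt_top hT hV0 hUi Λ η).ne
  have hG : P.IsChainGibbsMeasure T μ :=
    P.isChainGibbsMeasure_of_windowDensity hUm hVm hkm hφm hwm hD hfac hZ hμ
  -- Step 5: superstability
  have hSS : P.HasSuperstabilityEstimate μ :=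
    P.hasSuperstabilityEstimate_of_windowDensity hUm hVm hT hU0 hV0 hVe hUi2 hw' hk' hφB hL0 hD hμ
  exact ⟨μ, hG, hSS⟩

/-- **The pinned anharmonic chain has a superstable DLR Gibbs state at every temperature.** For
`pinnedChain ω₂ lam β γ` (`U = ω₂q²/2 + lam q⁴/4`, `V = r²/2 + βr⁴/4`) with `ω₂ > 0`, `lam, β ≥ 0`
and every `T > 0` there is a Gibbs state `μ_T` (`IsChainGibbsMeasure`) obeying Buttà–Marchioro's
superstability estimate (2.3) — the transfer-operator (Markov chain) state. This is the state half
of the "infinite-volume set-up" of the Fourier's-law routes; with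
`OscillatorChain.exists_bmDynamics` it is preserved by the Buttà–Marchioro dynamics.
[cite: Georgii2011, Thm 10.25 and §11.1] -/
theorem exists_isChainGibbsMeasure_hasSuperstabilityEstimate_pinnedChain {ω₂ lam β : ℝ} (γ : ℝ)
    (hω : 0 < ω₂) (hl : 0 ≤ lam) (hβ : 0 ≤ β) {T : ℝ} (hT : 0 < T) :
    ∃ μ : Measure ChainConfig, (pinnedChain ω₂ lam β γ).IsChainGibbsMeasure T μ ∧
      (pinnedChain ω₂ lam β γ).HasSuperstabilityEstimate μ := by
  refine (pinnedChain ω₂ lam β γ).exists_isChainGibbsMeasure_hasSuperstabilityEstimate hT ?_ ?_ ?_ ?_ ?_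
    (integrable_exp_neg_pinning hT hω hl β γ) ?_
  · show Continuous fun q : ℝ => ω₂ * q ^ 2 / 2 + lam * q ^ 4 / 4
    fun_prop
  · show Continuous fun r : ℝ => r ^ 2 / 2 + β * r ^ 4 / 4
    fun_prop
  · intro q
    show 0 ≤ ω₂ * q ^ 2 / 2 + lam * q ^ 4 / 4
    positivity
  · intro r
    show 0 ≤ r ^ 2 / 2 + β * r ^ 4 / 4
    positivity
  · intro r
    show (-r) ^ 2 / 2 + β * (-r) ^ 4 / 4 = r ^ 2 / 2 + β * r ^ 4 / 4
    ring
  · have h2T : 0 < 2 * T := by positivity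
    exact integrable_exp_neg_pinning h2T hω hl β γ

end OscillatorChain

end Literature.MathematicalPhysics.KineticTheory.HeatConduction

end
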